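import Mathlib.ModelTheory.Definability
import Mathlib.NumberTheory.Height.NumberField
import Mathlib.Analysis.SpecialFunctions.Log.Basic
import Literature.ModelTheory.ExponentialFields.Languages
import Literature.ModelTheory.ExponentialFields.Semialgebraic
import HarnessLib

/-!
# Wilkie's conjecture for `ℝ_exp` (Binyamini–Novikov–Zak 2024, Cor. 1), rational points

Topic `Literature/ModelTheory/ExponentialFields`, over the tree's `Language.orderedExpRing` (the
real exponential field `ℝ_exp = (ℝ, +, ·, -, 0, 1, exp, ≤)`, `Languages.lean`), Mathlib's semantic
definability `Set.Definable`, the tree's semialgebraic sets `IsSemialgebraic ℝ`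
(`Semialgebraic.lean`) and Mathlib's Weil height on `ℚ` (`Height.mulHeight₁`,
`Rat.mulHeight₁_eq_max`: `H(a/b) = max(|a|, b)` in lowest terms).

Source: G. Binyamini, D. Novikov, B. Zak, *Wilkie's conjecture for Pfaffian structures*, Ann. of
Math. 199 (2024) = arXiv:2202.05305 [BinyaminiNovikovZak2024], §1.1 (p. 3 of the arXiv version,
read): *"If `X ⊂ ℝⁿ` then following [Pila–Wilkie] we denote by `X^alg` the union of all connected,
positive-dimensional semialgebraic sets contained in `X`, and denote `X^trans := X ∖ X^alg`. For
`g, H ∈ ℕ` we denote `X(g, H) := {x ∈ X : [ℚ(x) : ℚ] ≤ g, H(x) ≤ H}`, `X(ℚ, H) := X(1, H)`, where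
`H(·)` denotes the multiplicative Weil height on `ℚ̄`, extended to `ℚ̄ⁿ` as the maximum of the
heights of the coordinates."* **Theorem 1.** *Let `X ∈ Ω_{F,D}`* [the FD-filtration of a sharply
o-minimal structure with sharp cell decomposition and sharp derivatives, e.g. `ℝ_rPfaff`]. *Then
`#X^trans(g, H) ≤ poly_F(D, g, log H)`.* **Corollary 1 (Wilkie's conjecture).** *Let `X` be
definable in `ℝ_exp`. Then `#X^trans(g, H) ≤ poly_X(g, log H)`* (§1.4: `Z = poly_X(Y)` means
`Z ≤ P_X(Y)` for a polynomial `P_X` with positive coefficients depending on `X`).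

## Contents

* `algPart X = X^alg` (union of the connected infinite semialgebraic subsets of `X`),
  `transPart X = X^trans = X ∖ X^alg`, `ratPointsLE X H = X(ℚ, H)` (points of `X` with rational
  coordinates of height `≤ H`); unfolding lemmas, `algPart_subset`, `transPart_subset`,
  `not_mem_algPart_iff` (the phrasing "lies on no infinite connected semialgebraic subset"),
  `ratPointsLE_mono`.
* `BinyaminiNovikovZak2024_cor_1_rat` — **named fact** (D-0014): Cor. 1 in the case `g = 1`
  (rational points, `X(ℚ, H)` — the original conjecture of Pila–Wilkie 2006, 1.11): for
  `X ⊆ ℝⁿ` definable (with parameters) in `ℝ_exp` there are `c`, `κ` with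
  `#X^trans(ℚ, H) ≤ c (log H + 1)^κ` for all `H ≥ 1`.
* Proved corollary `BinyaminiNovikovZak2024_cor_1_rat.integerPoints` — the count of integer points
  `k ∈ ℤⁿ`, `|kᵢ| ≤ H`, of `X^trans` is `≤ c (log H + 1)^κ` (integers of absolute value `≤ H` are
  rationals of height `≤ H`).

## Transcription notes

* *Special case only.* The fact is Cor. 1 with `g = 1` (rational points): a specialisation of the
  printed statement (never stronger). "positive-dimensional semialgebraic" is rendered "infinite
  semialgebraic" (a semialgebraic set has dimension `0` iff it is finite); "semialgebraic" is over
  `ℝ` (`IsSemialgebraic ℝ`); "definable in `ℝ_exp`" is Mathlib's `Set.Definable` with parameters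
  from all of `ℝ` in `Language.orderedExpRing`. `poly_X(1, log H)`, a polynomial in `log H ≥ 0`
  with positive coefficients, is bounded by `c (log H + 1)^κ`; the count of a set is rendered by
  `Set.Finite` together with `Set.ncard` (finiteness is part of the assertion).
* Not here: Theorem 1 (restricted sub-Pfaffian sets `ℝ_rPfaff`, the FD-filtration `Ω_{F,D}` of a
  sharply o-minimal structure and the uniformity `poly_F(D, g, log H)`) — it needs a
  restricted-Pfaffian vocabulary (Pfaffian chains on boxes, format, degree; Khovanskii 1991,
  Gabrielov–Vorobjov) that the tree does not have; nor the algebraic-points version `g > 1`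
  (heights of algebraic numbers of bounded degree), Thm. 2 (blocks), Lemma 2. In particular sets
  built from *restricted* `sin`, `cos` together with `exp` are covered by Thm. 1 (with the
  truncation device of the proof of Cor. 1), not by Cor. 1 as recorded here.
* Mathlib/tree search: no `algPart`/`transPart`/Pila–Wilkie counting vocabulary existed
  (`lean search`: `PilaWilkie`, `transcendental part`, `X^alg`).

## References

* G. Binyamini, D. Novikov, B. Zak, Ann. of Math. 199 (2024), 795–821,
  doi:10.4007/annals.2024.199.2.5 = arXiv:2202.05305: §1.1 (Thm. 1, Cor. 1), §1.4.
  [BinyaminiNovikovZak2024]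
* J. Pila, A. J. Wilkie, *The rational points of a definable set*, Duke Math. J. 133 (2006),
  1.1–1.11 (`X^alg`, `X^trans`, Conjecture 1.11). [PilaWilkie2006]
* J. Pila, *Point-counting and the Zilber–Pink conjecture*, CUP 2022, Conj. 10.1. [Pila2022]
-/

noncomputable section

open Set FirstOrder FirstOrder.Language

namespace Literature.ModelTheory.ExponentialFields

/-! ### The algebraic and transcendental parts; rational points of bounded height -/

section Parts

variable {ι : Type*}

/-- The **algebraic part** `X^alg` of `X ⊆ ℝ^ι`: the union of all connected, positive-dimensional
(= infinite) semialgebraic subsets of `X` (Pila–Wilkie 2006, 1.1; Binyamini–Novikov–Zak 2024,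
§1.1). Semialgebraic is over `ℝ` (`IsSemialgebraic ℝ`). [cite: BinyaminiNovikovZak2024, §1.1] -/
def algPart (X : Set (ι → ℝ)) : Set (ι → ℝ) :=
  ⋃₀ {A : Set (ι → ℝ) | A ⊆ X ∧ IsSemialgebraic ℝ A ∧ IsConnected A ∧ A.Infinite}

/-- The **transcendental part** `X^trans = X ∖ X^alg` (Pila–Wilkie 2006, 1.1;
Binyamini–Novikov–Zak 2024, §1.1). [cite: BinyaminiNovikovZak2024, §1.1] -/
def transPart (X : Set (ι → ℝ)) : Set (ι → ℝ) :=
  X \ algPart X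

/-- **`X(ℚ, H)`**: the points of `X` all of whose coordinates are rational numbers of
(multiplicative Weil) height at most `H` — Mathlib's `Height.mulHeight₁` on `ℚ`,
`H(a/b) = max(|a|, b)` in lowest terms (`Rat.mulHeight₁_eq_max`) (Binyamini–Novikov–Zak 2024,
§1.1: `X(ℚ, H) := X(1, H)`; Pila–Wilkie 2006, 1.2). [cite: BinyaminiNovikovZak2024, §1.1] -/
def ratPointsLE (X : Set (ι → ℝ)) (H : ℕ) : Set (ι → ℝ) :=
  {x ∈ X | ∀ i, ∃ q : ℚ, (q : ℝ) = x i ∧ Height.mulHeight₁ q ≤ H}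

variable {X : Set (ι → ℝ)}

/-- Membership in the algebraic part: `x` lies on some connected infinite semialgebraic subset of
`X`. [folklore] -/
theorem mem_algPart_iff {x : ι → ℝ} :
    x ∈ algPart X ↔ ∃ A : Set (ι → ℝ), x ∈ A ∧ A ⊆ X ∧ IsSemialgebraic ℝ A ∧ IsConnected A ∧
      A.Infinite := by
  simp only [algPart, mem_sUnion, mem_setOf_eq]
  exact ⟨fun ⟨A, hA, hx⟩ ↦ ⟨A, hx, hA⟩, fun ⟨A, hx, hA⟩ ↦ ⟨A, hA, hx⟩⟩

/-- `x ∉ X^alg` iff `x` lies on no connected infinite semialgebraic subset of `X` (the phrasing of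
counting statements "points not lying on any infinite connected semialgebraic subset").
[folklore] -/
theorem not_mem_algPart_iff {x : ι → ℝ} :
    x ∉ algPart X ↔ ¬∃ A : Set (ι → ℝ), x ∈ A ∧ A ⊆ X ∧ IsSemialgebraic ℝ A ∧ IsConnected A ∧
      A.Infinite :=
  mem_algPart_iff.not

/-- `X^alg ⊆ X`. [folklore] -/
theorem algPart_subset (X : Set (ι → ℝ)) : algPart X ⊆ X :=
  sUnion_subset fun _ hA ↦ hA.1

/-- Membership in the transcendental part (unfolding lemma). [folklore] -/
theorem mem_transPart_iff {x : ι → ℝ} : x ∈ transPart X ↔ x ∈ X ∧ x ∉ algPart X :=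
  Iff.rfl

/-- `X^trans ⊆ X`. [folklore] -/
theorem transPart_subset (X : Set (ι → ℝ)) : transPart X ⊆ X :=
  Set.sdiff_subset

/-- Membership in `X(ℚ, H)` (unfolding lemma). [folklore] -/
theorem mem_ratPointsLE_iff {H : ℕ} {x : ι → ℝ} :
    x ∈ ratPointsLE X H ↔ x ∈ X ∧ ∀ i, ∃ q : ℚ, (q : ℝ) = x i ∧ Height.mulHeight₁ q ≤ H :=
  Iff.rfl

/-- `X(ℚ, H) ⊆ X`. [folklore] -/
theorem ratPointsLE_subset (X : Set (ι → ℝ)) (H : ℕ) : ratPointsLE X H ⊆ X :=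
  fun _ hx ↦ hx.1

/-- `X(ℚ, H)` increases with `H`. [folklore] -/
theorem ratPointsLE_mono (X : Set (ι → ℝ)) {H H' : ℕ} (h : H ≤ H') :
    ratPointsLE X H ⊆ ratPointsLE X H' := fun x hx ↦
  ⟨hx.1, fun i ↦ by
    obtain ⟨q, hq, hqH⟩ := hx.2 i
    exact ⟨q, hq, hqH.trans (by exact_mod_cast h)⟩⟩

/-- An integer point `k` with `|kᵢ| ≤ H` (`H ≥ 1`) has rational coordinates of height `≤ H`
(`H(k) = max(|k|, 1)`). [folklore] -/
theorem intCast_mem_ratPointsLE {H : ℕ} (hH : 1 ≤ H) {k : ι → ℤ}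
    (hkX : (fun i ↦ (k i : ℝ)) ∈ X) (hk : ∀ i, |k i| ≤ H) :
    (fun i ↦ (k i : ℝ)) ∈ ratPointsLE X H := by
  refine ⟨hkX, fun i ↦ ⟨k i, by push_cast; rfl, ?_⟩⟩
  rw [Rat.mulHeight₁_eq_max, Rat.num_intCast, Rat.den_intCast]
  have h1 : ((k i).natAbs : ℝ) ≤ H := by
    have hki : ((k i).natAbs : ℤ) ≤ H := by
      rw [Int.natCast_natAbs]
      exact hk i
    exact_mod_cast hki
  push_cast
  exact max_le h1 (by exact_mod_cast hH)

end Parts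

/-! ### Corollary 1 for rational points (named fact) -/

section Fact

/-- **Binyamini–Novikov–Zak 2024, Corollary 1 (Wilkie's conjecture), for rational points.**
Printed: *"Let `X` be definable in `ℝ_exp`. Then `#X^trans(g, H) ≤ poly_X(g, log H)`"* (from
Thm. 1 for restricted sub-Pfaffian sets via Wilkie's theorem of the complement and truncation to
boxes). Recorded in the case `g = 1`, `X(ℚ, H) = X(1, H)` (Pila–Wilkie 2006, Conj. 1.11): for
every `n` and every `X ⊆ ℝⁿ` definable with parameters in the real exponential field
`(ℝ, +, ·, -, 0, 1, exp, ≤)` (`Language.orderedExpRing`), there are `c ∈ ℝ` and `κ ∈ ℕ` such that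
for every `H ≥ 1` the set `X^trans(ℚ, H)` of points of the transcendental part of `X` with
rational coordinates of height `≤ H` is finite, of cardinality `≤ c · (log H + 1)^κ` (a bound for
any polynomial in `log H` with positive coefficients).
[cite: BinyaminiNovikovZak2024, Cor. 1 (with §1.1, §1.4)] -/
def BinyaminiNovikovZak2024_cor_1_rat : Prop :=
  ∀ (n : ℕ) (X : Set (Fin n → ℝ)),
    (Set.univ : Set ℝ).Definable Language.orderedExpRing X →
      ∃ (c : ℝ) (κ : ℕ), ∀ H : ℕ, 1 ≤ H →
        (ratPointsLE (transPart X) H).Finite ∧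
          ((ratPointsLE (transPart X) H).ncard : ℝ) ≤ c * (Real.log H + 1) ^ κ

namespace BinyaminiNovikovZak2024_cor_1_rat

variable (h : BinyaminiNovikovZak2024_cor_1_rat)

include h

/-- Under Cor. 1: **integer points of the transcendental part are polylogarithmically sparse.**
For `X ⊆ ℝⁿ` definable in `ℝ_exp` there are `c`, `κ` such that for `H ≥ 1` the integer points
`k ∈ ℤⁿ` with `|kᵢ| ≤ H` and `k ∈ X^trans` — i.e. `k ∈ X` lying on no connected infinite
semialgebraic subset of `X` — are finite in number, at most `c (log H + 1)^κ` (they inject into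
`X^trans(ℚ, H)`, `intCast_mem_ratPointsLE`). [cite: BinyaminiNovikovZak2024, Cor. 1] -/
theorem integerPoints (n : ℕ) (X : Set (Fin n → ℝ))
    (hX : (Set.univ : Set ℝ).Definable Language.orderedExpRing X) :
    ∃ (c : ℝ) (κ : ℕ), ∀ H : ℕ, 1 ≤ H →
      {k : Fin n → ℤ | (∀ i, |k i| ≤ H) ∧ (fun i ↦ (k i : ℝ)) ∈ transPart X}.Finite ∧
        ({k : Fin n → ℤ | (∀ i, |k i| ≤ H) ∧ (fun i ↦ (k i : ℝ)) ∈ transPart X}.ncard : ℝ) ≤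
          c * (Real.log H + 1) ^ κ := by
  obtain ⟨c, κ, hcκ⟩ := h n X hX
  refine ⟨c, κ, fun H hH ↦ ?_⟩
  obtain ⟨hfin, hcard⟩ := hcκ H hH
  set S : Set (Fin n → ℤ) := {k | (∀ i, |k i| ≤ H) ∧ (fun i ↦ (k i : ℝ)) ∈ transPart X} with hS
  set ι : (Fin n → ℤ) → (Fin n → ℝ) := fun k i ↦ (k i : ℝ) with hι
  have hinj : Set.InjOn ι S := fun k _ k' _ hkk' ↦ funext fun i ↦ by
    have hi : (k i : ℝ) = (k' i : ℝ) := congrFun hkk' i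
    exact_mod_cast hi
  have hmaps : Set.MapsTo ι S (ratPointsLE (transPart X) H) := fun k hk ↦
    intCast_mem_ratPointsLE hH hk.2 hk.1
  have hSfin : S.Finite := Set.Finite.of_injOn hmaps hinj hfin
  refine ⟨hSfin, ?_⟩
  have hle : S.ncard ≤ (ratPointsLE (transPart X) H).ncard :=
    Set.ncard_le_ncard_of_injOn ι hmaps hinj hfin
  exact (Nat.cast_le.mpr hle).trans hcard

end BinyaminiNovikovZak2024_cor_1_rat

end Fact

end Literature.ModelTheory.ExponentialFields

end
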